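import Summits.BirchSwinnertonDyer.BirchSwinnertonDyer.Theorems.GenusKolyvaginAtTwoGenusPrimitiveSupplyAtTwoLoweringPrime
import HarnessLib

/-!
# Route `GenusKolyvaginAtTwo`, crux #2 `GenusPrimitiveSupplyAtTwo` (stmt-BirchSwinnertonDyer-22136):
# the image algebra of `E[2]` under the PRINTED hypothesis `E(ℚ)[2] = 0` (image of `ρ̄_{E,2}` = `C₃` or `S₃`): a fixed-point-free
# element, Prop. 9.1 at `2`, transitivity, the dichotomy — the inputs of Mazur–Rubin Lemma 3.6 / Prop. 5.2 without `ρ̄₂` onto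

Lead seat `bsd-line-gk2-p1` g8 (cell `bsd-f1-sign2`). THEOREMS ONLY (no definition, no named fact, no `sorry`); helper
`--supports stmt-BirchSwinnertonDyer-22136`; no item is closed; BSD is not proved by any of this.

WHY. `…LoweringPrime` / `…LoweringStep` prove Mazur–Rubin 2010 Prop. 5.2 over `ℚ` for `ρ̄_{E,2}` ONTO (the crux's habitat),
through gk2-p4's image algebra (`h1_restriction_injective_two_rat`, the dichotomy), which is typed for a surjective `ρ̄₂`.
The printed proposition (route item 24950 `MazurRubinProp52Rat := MazurRubin2010.prop52_rat`) assumes only `E(ℚ)[2] = 0`, i.e.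
`Gal(ℚ(E[2])/ℚ) ∈ {C₃, S₃}` («In either case `E[2]` is an irreducible `Γ`-module, and `H¹(Γ,E[2]) = 0`», MR p. 9). This file
removes the surjectivity: everything the argument uses is ONE element of `Γ_ℚ` acting on `E[2]` WITHOUT non-zero fixed points
(a `3`-cycle), and such an element exists as soon as `E[2]` has no non-zero `Γ_ℚ`-fixed point (§1: if no element is
fixed-point-free, every element is `1` or a transposition; two transpositions with different fixed points compose to a
`3`-cycle; one common fixed point is excluded).

* §1 `exists_smul_fixedPointFree` (a group acting additively on a `4`-group with no common non-zero fixed point contains a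
  fixed-point-free element — pure group theory on `{0, a, u, a+u}`).
* §2 (`hnt : ∀ P ∈ E[2], (∀ σ, σP = P) → P = 0`): `h1_restriction_injective_two_rat'` (Prop. 9.1 at `2`, via the tree's
  `KolyvaginImageTwo.eq_zero_of_h1Eval_eq_zero_two`), `exists_smul_eq_of_ne_zero'` (transitivity on `E[2] ∖ 0` by `z, z²`),
  the dichotomy, the commutator reduction and the non-vanishing lemma with `hsurj` replaced by `hnt`.
* §3 `forall_geomTorsion_two_eq_zero_of_natCard_torsionBy_eq_one` — `#E(ℚ)[2] = 1 ⟹ hnt` (Galois descent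
  `fixedPoints_eq_range_map_holds`: a `Γ_ℚ`-fixed point of `E(ℚ̄)` is rational), the bridge to the printed hypothesis.
Companion `…LoweringPrimeNoTwoTorsion`: Lemma 3.6 and the split twisting primes under `hnt`; then Prop. 5.2 for every `E/ℚ` with
`E(ℚ)[2] = 0` (`…LoweringStepNoTwoTorsion`).

References: [MazurRubin2010] arXiv:0904.3709: Lemma 3.6 (p. 9), Prop. 5.2 (p. 12); [GrossLMS1991] §9 Prop. 9.1, 9.6;
[LawsonWuthrich2016] Lemma 6; [SilvermanAEC2009] III.§2 Ex. 3.7, VIII.§1 (Galois descent).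
-/

set_option linter.dupNamespace false -- tree convention: `Summit.BirchSwinnertonDyer.BirchSwinnertonDyer.Theorems` (summit = sub-problem)
set_option autoImplicit false

noncomputable section

open scoped Classical Pointwise

namespace Summit.BirchSwinnertonDyer.BirchSwinnertonDyer.Theorems.GenusKolyLowering

open WeierstrassCurve NumberField IsDedekindDomain Field
open Literature.NumberTheory.GaloisRepresentations Literature.NumberTheory.EllipticCurves
open Literature.NumberTheory
open Summit.BirchSwinnertonDyer.BirchSwinnertonDyer.Theorems.GenusKolyTwistingPrime
open Summit.BirchSwinnertonDyer.BirchSwinnertonDyer.Theorems.KolyvaginImageTwo (mem_four apply_apply_eq_add_of_fixedPointFree)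

/-! ## §1 A group acting on the `4`-group without a common fixed point contains a fixed-point-free element -/

section FourGroup

variable {G T : Type*} [Group G] [AddCommGroup T] [DistribMulAction G T]

/-- **No common non-zero fixed point ⟹ some element acts fixed-point-freely** on an abelian group of exponent `2` and order `4`
(the image in `Aut T ≅ S₃` fixes no non-zero vector iff it is `C₃` or `S₃`, and both contain a `3`-cycle: if every element had
a non-zero fixed point, each would be `1` or a transposition; a transposition `σ₁` moving `a` fixes some `u ≠ a`, an element
`σ₀` moving `u` is a transposition fixing `a` or `a + u`, and `σ₀σ₁` is then a `3`-cycle). [folklore] -/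
theorem exists_smul_fixedPointFree (h2 : ∀ t : T, t + t = 0) (hcard : Nat.card T = 4)
    (hno : ∀ t : T, (∀ g : G, g • t = t) → t = 0) :
    ∃ z : G, ∀ t : T, z • t = t → t = 0 := by
  by_contra H
  push Not at H
  -- `H : ∀ z, ∃ t, z • t = t ∧ t ≠ 0`
  haveI : Finite T := Nat.finite_of_card_ne_zero (by rw [hcard]; norm_num)
  have hinj : ∀ (g : G) {s t : T}, g • s = g • t → s = t := fun g s t h ↦ smul_left_cancel g h
  have hne0 : ∀ (g : G) {t : T}, t ≠ 0 → g • t ≠ 0 := fun g t ht h ↦ ht ((smul_eq_zero_iff_eq g).mp h)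
  -- a non-zero `a` and an element `σ₁` moving it
  obtain ⟨a, ha⟩ : ∃ a : T, a ≠ 0 := by
    by_contra h
    push Not at h
    haveI : Subsingleton T := ⟨fun x y ↦ by rw [h x, h y]⟩
    have := Nat.card_of_subsingleton (0 : T)
    omega
  obtain ⟨σ₁, hσ₁a⟩ : ∃ σ₁ : G, σ₁ • a ≠ a := by
    by_contra h; push Not at h; exact ha (hno a h)
  obtain ⟨u, hσ₁u, hu⟩ := H σ₁
  have hua : u ≠ a := fun h ↦ hσ₁a (by rw [← h]; exact hσ₁u)
  -- `T = {0, a, u, a + u}`; `σ₁ a = a + u`, `σ₁ (a + u) = a`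
  have hmem := mem_four h2 hcard ha hu hua
  have hσ₁a' : σ₁ • a = a + u := by
    rcases hmem (σ₁ • a) with h | h | h | h
    · exact absurd h (hne0 σ₁ ha)
    · exact absurd h hσ₁a
    · exact absurd (hinj σ₁ (h.trans hσ₁u.symm)) hua.symm
    · exact h
  have hσ₁au : σ₁ • (a + u) = a := by
    rw [smul_add, hσ₁a', hσ₁u, add_assoc, h2 u, add_zero]
  -- an element `σ₀` moving `u`, with a non-zero fixed point `v ∈ {a, a + u}`
  obtain ⟨σ₀, hσ₀u⟩ : ∃ σ₀ : G, σ₀ • u ≠ u := by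
    by_contra h; push Not at h; exact hu (hno u h)
  obtain ⟨v, hσ₀v, hv⟩ := H σ₀
  have hvu : v ≠ u := fun h ↦ hσ₀u (by rw [← h]; exact hσ₀v)
  have hau0 : a + u ≠ 0 := fun h ↦ hua (by
    have := eq_neg_of_add_eq_zero_left h
    rw [this, neg_eq_of_add_eq_zero_left (h2 u)])
  -- the `3`-cycle `z = σ₀ σ₁` has no non-zero fixed point: contradiction with `H z`
  have key : ∀ {p q r : T}, p ≠ 0 → q ≠ 0 → q ≠ p →
      (σ₀ * σ₁) • p = q → (σ₀ * σ₁) • q = p + q → (σ₀ * σ₁) • (p + q) = p → False := by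
    intro p q r hp hq hqp h1 h2' h3
    obtain ⟨t, ht, ht0⟩ := H (σ₀ * σ₁)
    rcases mem_four h2 hcard hp hq hqp t with rfl | rfl | rfl | rfl
    · exact ht0 rfl
    · exact hqp (by rw [h1] at ht; exact ht)
    · -- `p + q = q` ⟹ `p = 0`
      rw [h2'] at ht
      exact hp (by simpa using ht)
    · -- `p = p + q` ⟹ `q = 0`
      rw [h3] at ht
      exact hq (left_eq_add.mp ht)
  rcases hmem v with h | h | h | h
  · exact hv h
  · -- `σ₀` fixes `a`, so `σ₀ u = a + u`, `σ₀ (a + u) = u`; `z: a ↦ u ↦ a + u ↦ a`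
    have hσ₀a : σ₀ • a = a := by rw [← h]; exact hσ₀v
    have hσ₀u' : σ₀ • u = a + u := by
      rcases hmem (σ₀ • u) with h' | h' | h' | h'
      · exact absurd h' (hne0 σ₀ hu)
      · exact absurd (hinj σ₀ (h'.trans hσ₀a.symm)) hua
      · exact absurd h' hσ₀u
      · exact h'
    have hσ₀au : σ₀ • (a + u) = u := by
      rw [smul_add, hσ₀a, hσ₀u', ← add_assoc, h2 a, zero_add]
    refine key (p := a) (q := u) (r := a + u) ha hu hua ?_ ?_ ?_
    · rw [mul_smul, hσ₁a', hσ₀au]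
    · rw [mul_smul, hσ₁u, hσ₀u']
    · rw [mul_smul, hσ₁au, hσ₀a]
  · exact absurd h hvu
  · -- `σ₀` fixes `a + u`, so `σ₀ u = a`, `σ₀ a = u`; `z: a ↦ a + u ↦ u ↦ a`
    have hσ₀au : σ₀ • (a + u) = a + u := by rw [← h]; exact hσ₀v
    have hσ₀u' : σ₀ • u = a := by
      rcases hmem (σ₀ • u) with h' | h' | h' | h'
      · exact absurd h' (hne0 σ₀ hu)
      · exact h'
      · exact absurd h' hσ₀u
      · exfalso
        have huau : u = a + u := hinj σ₀ (h'.trans hσ₀au.symm)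
        exact ha (by simpa using huau.symm)
    have haau : a + (a + u) = u := by rw [← add_assoc, h2 a, zero_add]
    have hσ₀a : σ₀ • a = u := by
      have : a = (a + u) + u := by rw [add_assoc, h2 u, add_zero]
      rw [this, smul_add, hσ₀au, hσ₀u', add_assoc, add_comm u a, haau]
    refine key (p := a) (q := a + u) (r := u) ha hau0 (fun h' ↦ hu (by simpa using h'.symm)) ?_ ?_ ?_
    · rw [mul_smul, hσ₁a', hσ₀au]
    · rw [mul_smul, hσ₁au, hσ₀a, haau]
    · rw [haau, mul_smul, hσ₁u, hσ₀u']

end FourGroup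

/-! ## §2 Image algebra over `ℚ` at level `2` under `E(ℚ)[2] = 0` (no `Γ_ℚ`-fixed non-zero point of `E[2]`) -/

section Image

variable (W : WeierstrassCurve ℚ) [W.IsElliptic]

/-- **A fixed-point-free element of `Γ_ℚ` on `E[2]`** when `E[2]` has no non-zero `Γ_ℚ`-fixed point (image `C₃` or `S₃`).
[cite: MazurRubin2010, proof of Lemma 3.5–3.6 (arXiv:0904.3709 p. 9: «either `Γ ≅ S₃` or `Γ ≅ ℤ/3ℤ`»)] -/
theorem exists_smul_fixedPointFree_rat
    (hnt : ∀ P : geomTorsion W (2 : ℤ), (∀ σ : absoluteGaloisGroup ℚ, σ • P = P) → P = 0) :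
    ∃ z : absoluteGaloisGroup ℚ, ∀ P : geomTorsion W (2 : ℤ), z • P = P → P = 0 :=
  exists_smul_fixedPointFree (fun P ↦ by rw [← two_nsmul]; exact AddSubgroup.torsionBy.nsmul P)
    (natCard_geomTorsion_two_rat W) hnt

/-- **Gross's Prop. 9.1 at `p = 2` over `ℚ` under `E(ℚ)[2] = 0`**: restriction `H¹(ℚ, E[2]) → Hom(Γ_{ℚ(E[2])}, E[2])` is
injective (`H¹(C₃, 𝔽₂²) = H¹(S₃, 𝔽₂²) = 0`; tree `KolyvaginImageTwo.eq_zero_of_h1Eval_eq_zero_two` from a fixed-point-free element).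
[cite: MazurRubin2010, proof of Lemma 3.6 («`H¹(Γ,E[2]) = 0`»)] [cite: GrossLMS1991, §9 Prop. 9.1] [cite: LawsonWuthrich2016, Lemma 6] -/
theorem h1_restriction_injective_two_rat'
    (hnt : ∀ P : geomTorsion W (2 : ℤ), (∀ σ : absoluteGaloisGroup ℚ, σ • P = P) → P = 0)
    {x : galH1Torsion W (2 : ℤ)} (hx : ∀ ρ ∈ torsionFixing W (2 : ℤ), h1Eval W (2 : ℤ) x ρ = 0) : x = 0 := by
  obtain ⟨z, hz⟩ := exists_smul_fixedPointFree_rat W hnt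
  exact KolyvaginImageTwo.eq_zero_of_h1Eval_eq_zero_two W (natCard_geomTorsion_two_rat W) hz hx

/-- **`Γ_ℚ` is transitive on `E[2] ∖ 0`** under `E(ℚ)[2] = 0`: the fixed-point-free `z` is a `3`-cycle, `{v, zv, z²v} = E[2] ∖ 0`.
[folklore] -/
theorem exists_smul_eq_of_ne_zero'
    (hnt : ∀ P : geomTorsion W (2 : ℤ), (∀ σ : absoluteGaloisGroup ℚ, σ • P = P) → P = 0)
    {v P : geomTorsion W (2 : ℤ)} (hv : v ≠ 0) (hP : P ≠ 0) : ∃ σ : absoluteGaloisGroup ℚ, σ • v = P := by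
  have h2 : ∀ t : geomTorsion W (2 : ℤ), t + t = 0 := fun t ↦ by
    rw [← two_nsmul]; exact AddSubgroup.torsionBy.nsmul t
  obtain ⟨z, hz⟩ := exists_smul_fixedPointFree_rat W hnt
  let zA : geomTorsion W (2 : ℤ) ≃+ geomTorsion W (2 : ℤ) := DistribMulAction.toAddEquiv _ z
  have hzA : ∀ t, zA t = z • t := fun _ ↦ rfl
  obtain ⟨hzv0, hzvv, hzz⟩ := apply_apply_eq_add_of_fixedPointFree h2 (natCard_geomTorsion_two_rat W) zA
    (fun t ht ↦ hz t ht) hv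
  rw [hzA] at hzv0 hzvv
  rw [hzA, hzA] at hzz
  rcases mem_four h2 (natCard_geomTorsion_two_rat W) hv hzv0 hzvv P with h | h | h | h
  · exact absurd h hP
  · exact ⟨1, by rw [one_smul, h]⟩
  · exact ⟨z, h.symm⟩
  · exact ⟨z * z, by rw [mul_smul, hzz, h]⟩

/-- **DICHOTOMY under `E(ℚ)[2] = 0`** (as gk2-p4's `forall_h1Eval_eq_zero_or_forall_exists_h1Eval_eq`, `hsurj` replaced by `hnt`): on a
conjugation-stable `B ≤ Γ_{ℚ(E[2])}`, `[x, ·]` is identically `0` or ONTO `E[2]`. [cite: MazurRubin2010, Lemma 3.5–3.6]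
[cite: GrossLMS1991, §9 (pairing after Prop. 9.1)] -/
theorem forall_h1Eval_eq_zero_or_forall_exists_h1Eval_eq'
    (hnt : ∀ P : geomTorsion W (2 : ℤ), (∀ σ : absoluteGaloisGroup ℚ, σ • P = P) → P = 0)
    (x : galH1Torsion W (2 : ℤ)) (B : Subgroup (absoluteGaloisGroup ℚ))
    (hBT : B ≤ torsionFixing W (2 : ℤ))
    (hBconj : ∀ (σ : absoluteGaloisGroup ℚ) {h : absoluteGaloisGroup ℚ}, h ∈ B → σ * h * σ⁻¹ ∈ B) :
    (∀ h ∈ B, h1Eval W (2 : ℤ) x h = 0) ∨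
      (∀ P : geomTorsion W (2 : ℤ), ∃ h ∈ B, h1Eval W (2 : ℤ) x h = P) := by
  by_cases hall : ∀ h ∈ B, h1Eval W (2 : ℤ) x h = 0
  · exact Or.inl hall
  refine Or.inr fun P ↦ ?_
  push Not at hall
  obtain ⟨h₁, hh₁B, hv₁⟩ := hall
  by_cases hP0 : P = 0
  · exact ⟨1, B.one_mem, by rw [hP0, h1Eval_one]⟩
  obtain ⟨σ, hσ⟩ := exists_smul_eq_of_ne_zero' W hnt hv₁ hP0
  exact ⟨σ * h₁ * σ⁻¹, hBconj σ hh₁B, by rw [h1Eval_conj W _ x σ (hBT hh₁B), hσ]⟩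

/-- **Abelian side conditions are free, under `E(ℚ)[2] = 0`** (as gk2-p4's `exists_torsionFixing_mem_h1Eval_ne_of_commutator_mem`):
`x ≠ 0 ⟹ [x, h] ≠ 0` for some `h ∈ Γ_{ℚ(E[2])} ∩ A`, for any `A` containing all commutators. [cite: MazurRubin2010, Lemma 3.5–3.6]
[cite: GrossLMS1991, §9 Prop. 9.1] -/
theorem exists_torsionFixing_mem_h1Eval_ne'
    (hnt : ∀ P : geomTorsion W (2 : ℤ), (∀ σ : absoluteGaloisGroup ℚ, σ • P = P) → P = 0)
    {x : galH1Torsion W (2 : ℤ)} (hx : x ≠ 0)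
    (A : Subgroup (absoluteGaloisGroup ℚ)) (hA : ∀ γ δ : absoluteGaloisGroup ℚ, γ * δ * γ⁻¹ * δ⁻¹ ∈ A) :
    ∃ h ∈ torsionFixing W (2 : ℤ), h ∈ A ∧ h1Eval W (2 : ℤ) x h ≠ 0 := by
  by_contra hcon
  push Not at hcon
  apply hx
  apply h1_restriction_injective_two_rat' W hnt
  intro ρ hρ
  apply hnt
  intro γ
  have hc1 : γ * ρ * γ⁻¹ ∈ torsionFixing W (2 : ℤ) := (torsionFixing_normal W _).conj_mem ρ hρ γ
  have hcomm : γ * ρ * γ⁻¹ * ρ⁻¹ ∈ torsionFixing W (2 : ℤ) := mul_mem hc1 (inv_mem hρ)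
  have h0 := hcon _ hcomm (hA γ ρ)
  rw [h1Eval_mul W _ x hc1, h1Eval_conj W _ x γ hρ, h1Eval_inv W _ x hρ, add_neg_eq_zero] at h0
  exact h0

end Image

/-! ## §3 The bridge to the printed hypothesis `#E(ℚ)[2] = 1` -/

section Bridge

variable (W : WeierstrassCurve ℚ) [W.IsElliptic]

omit [W.IsElliptic] in
/-- **`E(ℚ)[2] = 0` ⟹ `E[2]` has no non-zero `Γ_ℚ`-fixed point** (Galois descent: a `Γ_ℚ`-fixed point of `E(ℚ̄)` is the base
change of a rational point — tree `fixedPoints_eq_range_map_holds`; a rational point with `2P = 0` is `2`-torsion; `#E(ℚ)[2] = 1`).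
[cite: SilvermanAEC2009, VIII.§1 (proof of Prop. 1.2)] -/
theorem forall_geomTorsion_two_eq_zero_of_natCard_torsionBy_eq_one
    (h1 : Nat.card (AddSubgroup.torsionBy W.toAffine.Point ((2 : ℕ) : ℤ)) = 1) :
    ∀ P : geomTorsion W (2 : ℤ), (∀ σ : absoluteGaloisGroup ℚ, σ • P = P) → P = 0 := by
  intro P hP
  let β : W.toAffine.Point →+ geomPoints W := Affine.Point.baseChange (W' := W.toAffine) ℚ (AlgebraicClosure ℚ)
  have hβ : Function.Injective β := Affine.Point.map_injective _
  have hfix : (P : geomPoints W) ∈ MulAction.fixedPoints (absoluteGaloisGroup ℚ) (geomPoints W) := by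
    intro σ
    have h := congrArg (fun Q : geomTorsion W (2 : ℤ) ↦ (Q : geomPoints W)) (hP σ)
    simpa [AddSubgroup.torsionBy.coe_smul] using h
  rw [fixedPoints_eq_range_map_holds W] at hfix
  obtain ⟨Q₀, hQ₀⟩ := hfix
  set Q : W.toAffine.Point := Q₀ with hQdef
  have hQ : β Q = (P : geomPoints W) := hQ₀
  have hP2 : 2 • (P : geomPoints W) = 0 := by
    have h : 2 • P = 0 := AddSubgroup.torsionBy.nsmul P
    rw [← AddSubgroupClass.coe_nsmul, h, ZeroMemClass.coe_zero]
  have h2Q : 2 • Q = 0 := by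
    apply hβ
    rw [map_nsmul, hQ, hP2, map_zero]
  have hQ2 : Q ∈ AddSubgroup.torsionBy W.toAffine.Point ((2 : ℕ) : ℤ) := AddSubgroup.torsionBy.nsmul_iff.mpr h2Q
  have hQ0 : Q = 0 := by
    have hsub : Subsingleton (AddSubgroup.torsionBy W.toAffine.Point ((2 : ℕ) : ℤ)) :=
      (Nat.card_eq_one_iff_unique.mp h1).1
    have := hsub.elim ⟨Q, hQ2⟩ ⟨0, AddSubgroup.zero_mem _⟩
    exact congrArg Subtype.val this
  apply Subtype.ext
  change (P : geomPoints W) = 0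
  rw [← hQ, hQ0, map_zero]

end Bridge

end Summit.BirchSwinnertonDyer.BirchSwinnertonDyer.Theorems.GenusKolyLowering

end
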